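import Mathlib
import Literature.Combinatorics.Additive.TripleProductProperty

/-!
# Frame packings in `(ℤ/n)³`, all moduli `n ≥ 5`: two frame triples are STPP-compatible only as cyclic
# relabelings (structural form of the census clause K-F3 for composite moduli too)

Support file for route `MatrixMultiplication/GroupTheoreticSTPP` (target `CThesis`, stmt-MatrixMultiplication-0593),
cell `mm-stpp` (D-0046), CENSUS-PLAN §4 F3 / §7 S5.  Companion of `GroupTheoreticSTPPCThesisFramePacking.lean`,
which proves the same classification over the FIELD `𝔽_p`, `p ≥ 5` prime, by a counting step that divides
(`μ ∉ {0, a/a′, b/b′}`).  Here the host is `H = (ℤ/n)³` (`Fin 3 → ZMod n`) for an ARBITRARY modulus `n ≥ 5`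
— the setting of the cell's census (`k_max^{frame}(n) = 2` for all `3 ≤ n ≤ 32`, both engines) — and the
counting step is replaced by a division-free argument using only the scalars `1, 2, 3, 4`:

* `parallel_pair_of_two_line` — in `ZMod n`, `n ≥ 5`: if for all non-zero `λ, μ` one has `λa − μa′ = 0`
  or `λb − μb′ = 0`, then `a = a′ = 0` or `b = b′ = 0`.  (At `(λ,μ) = (1,1)` one pair agrees, say
  `a = a′ = α ≠ 0`; then `(λ−μ)α ≠ 0` at `(2,1), (1,2)` gives `b′ = 2b`, `b = 2b′`, so `3b = 0`; at `(3,1)`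
  either `2α ≠ 0` and `b′ = 3b`, or `2α = 0`, `3α = α ≠ 0` at `(4,1)` and `b′ = 4b`; both force
  `b = b′ = 0`.  For `n = 3` the statement fails: `a = a′ = b = 1`, `b′ = 2`.)
* `two_line_conditions`, `frame_pair_classification` — verbatim as in the prime file: for a frame
  `(v₀, v₁, v₂)` with `det v ≠ 0` (a non-zero determinant suffices for this step, invertibility is not
  needed) and `{T_axes, T_v}` STPP, `(L(v₀), L(v₁), L(v₂))` is `(H₁, H₂, H₀)` or `(H₂, H₀, H₁)`;
* `not_addSimultaneousTPP_axes_rot_rot2` — the three cyclic relabelings together violate pattern `(0,1,2)`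
  (any modulus `n ≥ 2`).

Sets are given by membership hypotheses: `x ∈ A 0 ↔ x 0 ≠ 0 ∧ x 1 = x 2 = 0` (punctured axes),
`x ∈ A 1 ↔ ∃ c ≠ 0, x = c • v₀` (all non-zero multiples of the frame vector; for a column of an invertible
matrix over `ℤ/n` this is exactly the image of the punctured axis, the census convention).

WHAT THIS IS NOT: a statement about the frame template only; nothing about arbitrary `(n−1, n−1, n−1)`
sets (CENSUS-PLAN F3b), the moduli `n = 3, 4` (census), or `ω`.

## References
* H. Cohn, R. Kleinberg, B. Szegedy, C. Umans, FOCS 2005, Def. 5.1, Prop. 5.2 (the design in `Cyc_n³`).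
-/

-- single-conjunct summit: the mandated namespace repeats `MatrixMultiplication`.
set_option linter.dupNamespace false

namespace Summit.MatrixMultiplication.MatrixMultiplication.Theorems

namespace FramePackingZMod

open Finset Literature.Combinatorics.Additive

variable {n : ℕ}

/-! ### Arithmetic in `ZMod n` -/

/-- In `ZMod n` with `n ≥ k + 1`, the numeral `k ≥ 1` is non-zero. [folklore] -/
theorem natCast_ne_zero_of_lt {k : ℕ} (hk : 0 < k) (hkn : k < n) : ((k : ℕ) : ZMod n) ≠ 0 := by
  intro h
  rw [ZMod.natCast_eq_zero_iff] at h
  exact absurd (Nat.le_of_dvd hk h) (by omega)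

/-- In `ZMod n`, `n ≥ 3`, for every `t` there is `s ≠ 0` with `s + t ≠ 0`. [folklore] -/
theorem exists_ne_zero_add_ne_zero (hn : 3 ≤ n) (t : ZMod n) : ∃ s : ZMod n, s ≠ 0 ∧ s + t ≠ 0 := by
  have h1 : (1 : ZMod n) ≠ 0 := by
    have := natCast_ne_zero_of_lt (n := n) (k := 1) one_pos (by omega); simpa using this
  have h2 : (2 : ZMod n) ≠ 0 := by
    have := natCast_ne_zero_of_lt (n := n) (k := 2) two_pos (by omega); simpa using this
  by_cases h : (1 : ZMod n) + t = 0
  · refine ⟨2, h2, ?_⟩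
    have ht : t = -1 := by linear_combination h
    rw [ht]
    have : (2 : ZMod n) + -1 = 1 := by ring
    rw [this]; exact h1
  · exact ⟨1, h1, h⟩

/-! ### The extraction lemma: avoiding `P_α + P_β + (P_γ − P_γ) + w` forces a zero coordinate of `w` -/

/-- **Generic two-line extraction** over `(ℤ/n)³`, `n ≥ 3`.  Let `P, Q, R` be the punctured axes in the
three coordinates `α, β, γ` (membership hypotheses).  If `x + y + (r − r') + w ≠ 0` for all `x ∈ P`,
`y ∈ Q`, `r, r' ∈ R`, then `w α = 0` or `w β = 0`. [folklore] -/
theorem zero_or_zero_of_avoid (hn : 3 ≤ n) {α β γ : Fin 3} (hαβ : α ≠ β) (hαγ : α ≠ γ) (hβγ : β ≠ γ)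
    (hcov : ∀ i : Fin 3, i = α ∨ i = β ∨ i = γ)
    {P Q R : Finset (Fin 3 → ZMod n)}
    (hP : ∀ x, x ∈ P ↔ x α ≠ 0 ∧ ∀ j, j ≠ α → x j = 0)
    (hQ : ∀ x, x ∈ Q ↔ x β ≠ 0 ∧ ∀ j, j ≠ β → x j = 0)
    (hR : ∀ x, x ∈ R ↔ x γ ≠ 0 ∧ ∀ j, j ≠ γ → x j = 0)
    {w : Fin 3 → ZMod n}
    (havoid : ∀ x ∈ P, ∀ y ∈ Q, ∀ r ∈ R, ∀ r' ∈ R, x + y + (r - r') + w ≠ 0) :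
    w α = 0 ∨ w β = 0 := by
  by_contra hne
  rw [not_or] at hne
  obtain ⟨hα, hβ⟩ := hne
  obtain ⟨s, hs0, hst⟩ := exists_ne_zero_add_ne_zero hn (w γ)
  have hx : Pi.single α (-(w α)) ∈ P := by
    rw [hP]; exact ⟨by simp [hα], fun j hj => by simp [Pi.single_eq_of_ne hj]⟩
  have hy : Pi.single β (-(w β)) ∈ Q := by
    rw [hQ]; exact ⟨by simp [hβ], fun j hj => by simp [Pi.single_eq_of_ne hj]⟩
  have hr : Pi.single γ s ∈ R := by
    rw [hR]; exact ⟨by simp [hs0], fun j hj => by simp [Pi.single_eq_of_ne hj]⟩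
  have hr' : Pi.single γ (s + w γ) ∈ R := by
    rw [hR]; exact ⟨by simp [hst], fun j hj => by simp [Pi.single_eq_of_ne hj]⟩
  refine havoid _ hx _ hy _ hr _ hr' ?_
  funext i
  simp only [Pi.add_apply, Pi.sub_apply, Pi.zero_apply]
  rcases hcov i with rfl | rfl | rfl
  · rw [Pi.single_eq_same, Pi.single_eq_of_ne hαβ, Pi.single_eq_of_ne hαγ, Pi.single_eq_of_ne hαγ]
    ring
  · rw [Pi.single_eq_same, Pi.single_eq_of_ne (Ne.symm hαβ), Pi.single_eq_of_ne hβγ,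
      Pi.single_eq_of_ne hβγ]
    ring
  · rw [Pi.single_eq_same, Pi.single_eq_same, Pi.single_eq_of_ne (Ne.symm hαγ),
      Pi.single_eq_of_ne (Ne.symm hβγ)]
    ring

/-! ### The counting step over `ℤ/n`, `n ≥ 5` (division-free) -/

/-- Half of the counting step: if for all non-zero `λ, μ` one has `λa − μa' = 0 ∨ λb − μb' = 0` and
`a = a' ≠ 0`, then `b = b' = 0` (`n ≥ 5`; uses the scalars `1, 2, 3, 4` only). [folklore] -/
theorem eq_zero_of_eq_of_ne_zero (hn : 5 ≤ n) {a b b' : ZMod n} (ha : a ≠ 0)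
    (h : ∀ lam mu : ZMod n, lam ≠ 0 → mu ≠ 0 → lam * a - mu * a = 0 ∨ lam * b - mu * b' = 0) :
    b = 0 ∧ b' = 0 := by
  have h1 : (1 : ZMod n) ≠ 0 := by
    have := natCast_ne_zero_of_lt (n := n) (k := 1) one_pos (by omega); simpa using this
  have h2 : (2 : ZMod n) ≠ 0 := by
    have := natCast_ne_zero_of_lt (n := n) (k := 2) two_pos (by omega); simpa using this
  have h3 : (3 : ZMod n) ≠ 0 := by
    have := natCast_ne_zero_of_lt (n := n) (k := 3) three_pos (by omega); simpa using this
  have h4 : (4 : ZMod n) ≠ 0 := by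
    have := natCast_ne_zero_of_lt (n := n) (k := 4) four_pos (by omega); simpa using this
  -- `(2,1)`: `b' = 2b`; `(1,2)`: `b = 2b'`
  have e21 : 2 * b - 1 * b' = 0 := (h 2 1 h2 h1).resolve_left (by
    intro h0; apply ha; linear_combination h0)
  have e12 : 1 * b - 2 * b' = 0 := (h 1 2 h1 h2).resolve_left (by
    intro h0; apply ha; linear_combination -h0)
  have h3b : 3 * b = 0 := by linear_combination 2 * e21 - e12
  by_cases h2a : 2 * a = 0
  · -- `(4,1)`: `3a = a ≠ 0`, so `b' = 4b`
    have e41 : 4 * b - 1 * b' = 0 := (h 4 1 h4 h1).resolve_left (by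
      intro h0; apply ha; linear_combination h0 - h2a)
    constructor
    · linear_combination e21 - e41 + h3b
    · linear_combination e21 - 2 * e41 + 2 * h3b
  · -- `(3,1)`: `2a ≠ 0`, so `b' = 3b = 0`
    have e31 : 3 * b - 1 * b' = 0 := (h 3 1 h3 h1).resolve_left (by
      intro h0; apply h2a; linear_combination h0)
    constructor
    · linear_combination 2 * e21 - 2 * e31 + h3b
    · linear_combination h3b - e31

/-- **Two lines with a two-coordinate alternative are jointly planar** over `ℤ/n`, `n ≥ 5`: if for all
non-zero `λ, μ ∈ ℤ/n` one has `λa − μa' = 0` or `λb − μb' = 0`, then `a = a' = 0` or `b = b' = 0`.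
Division-free replacement of the field argument of the prime file (there: `μ ∉ {0, a/a', b/b'}`); false
for `n = 3` (`a = a' = b = 1`, `b' = 2`). [folklore] -/
theorem parallel_pair_of_two_line (hn : 5 ≤ n) {a a' b b' : ZMod n}
    (h : ∀ lam mu : ZMod n, lam ≠ 0 → mu ≠ 0 → lam * a - mu * a' = 0 ∨ lam * b - mu * b' = 0) :
    (a = 0 ∧ a' = 0) ∨ (b = 0 ∧ b' = 0) := by
  have h1 : (1 : ZMod n) ≠ 0 := by
    have := natCast_ne_zero_of_lt (n := n) (k := 1) one_pos (by omega); simpa using this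
  by_cases ha : a = 0 ∧ a' = 0
  · exact Or.inl ha
  by_cases hb : b = 0 ∧ b' = 0
  · exact Or.inr hb
  exfalso
  rcases h 1 1 h1 h1 with e | e
  · -- `a = a'`
    have haa : a = a' := by linear_combination e
    subst haa
    have ha0 : a ≠ 0 := fun h0 => ha ⟨h0, h0⟩
    exact hb (eq_zero_of_eq_of_ne_zero hn ha0 h)
  · -- `b = b'`
    have hbb : b = b' := by linear_combination e
    subst hbb
    have hb0 : b ≠ 0 := fun h0 => hb ⟨h0, h0⟩
    exact ha (eq_zero_of_eq_of_ne_zero hn hb0 fun lam mu hl hm => (h lam mu hl hm).symm)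

/-- Passing from vectors to coordinates: `(λ•u − μ•u') i = λ uᵢ − μ u'ᵢ`. [folklore] -/
theorem parallel_pair_of_vectors (hn : 5 ≤ n) {u u' : Fin 3 → ZMod n} {α β : Fin 3}
    (h : ∀ lam mu : ZMod n, lam ≠ 0 → mu ≠ 0 → (lam • u - mu • u') α = 0 ∨ (lam • u - mu • u') β = 0) :
    (u α = 0 ∧ u' α = 0) ∨ (u β = 0 ∧ u' β = 0) := by
  refine parallel_pair_of_two_line hn fun lam mu hl hm => ?_
  have := h lam mu hl hm
  simpa only [Pi.sub_apply, Pi.smul_apply, smul_eq_mul] using this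

/-! ### The classification -/

section Classification

variable {A B C : Fin 2 → Finset (Fin 3 → ZMod n)} {v₀ v₁ v₂ : Fin 3 → ZMod n}

/-- **The three two-line conditions** (any modulus `n ≥ 3`).  If `{T_axes, T_v}` is STPP (additive CKSU
Def. 5.1, index `0` the axes, index `1` the frame `v`), then the index patterns `(0,1,0)`, `(0,0,1)`,
`(1,0,0)` of clause (ii) give: for all non-zero `λ, μ`, `λv₁ − μv₀` vanishes in coordinate `0` or `1`;
`λv₂ − μv₁` in `1` or `2`; `λv₀ − μv₂` in `0` or `2`. [cite: CohnKleinbergSzegedyUmans2005, Def. 5.1] -/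
theorem two_line_conditions (hn : 3 ≤ n)
    (hA0 : ∀ x, x ∈ A 0 ↔ x 0 ≠ 0 ∧ ∀ j, j ≠ 0 → x j = 0)
    (hB0 : ∀ x, x ∈ B 0 ↔ x 1 ≠ 0 ∧ ∀ j, j ≠ 1 → x j = 0)
    (hC0 : ∀ x, x ∈ C 0 ↔ x 2 ≠ 0 ∧ ∀ j, j ≠ 2 → x j = 0)
    (hA1 : ∀ x, x ∈ A 1 ↔ ∃ c : ZMod n, c ≠ 0 ∧ x = c • v₀)
    (hB1 : ∀ x, x ∈ B 1 ↔ ∃ c : ZMod n, c ≠ 0 ∧ x = c • v₁)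
    (hC1 : ∀ x, x ∈ C 1 ↔ ∃ c : ZMod n, c ≠ 0 ∧ x = c • v₂)
    (hS : AddSimultaneousTPP A B C) :
    (∀ lam mu : ZMod n, lam ≠ 0 → mu ≠ 0 → (lam • v₁ - mu • v₀) 0 = 0 ∨ (lam • v₁ - mu • v₀) 1 = 0) ∧
    (∀ lam mu : ZMod n, lam ≠ 0 → mu ≠ 0 → (lam • v₂ - mu • v₁) 1 = 0 ∨ (lam • v₂ - mu • v₁) 2 = 0) ∧
    (∀ lam mu : ZMod n, lam ≠ 0 → mu ≠ 0 → (lam • v₀ - mu • v₂) 0 = 0 ∨ (lam • v₀ - mu • v₂) 2 = 0) := by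
  have h01 : (0 : Fin 2) ≠ 1 := by decide
  -- punctured axes are closed under negation (tree: `Prop52Maximal.neg_mem_axis`)
  have negmem : ∀ {P : Finset (Fin 3 → ZMod n)} {α : Fin 3},
      (∀ x, x ∈ P ↔ x α ≠ 0 ∧ ∀ j, j ≠ α → x j = 0) → ∀ {x : Fin 3 → ZMod n}, x ∈ P → -x ∈ P := by
    intro P α hP x hx
    rw [hP] at hx ⊢
    exact ⟨by simpa using hx.1, fun j hj => by simp [hx.2 j hj]⟩
  refine ⟨fun lam mu hl hm => ?_, fun lam mu hl hm => ?_, fun lam mu hl hm => ?_⟩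
  · -- pattern (0,1,0): a ∈ A0, a' = μv₀ ∈ A1, b = λv₁ ∈ B1, b' ∈ B0, c, c' ∈ C0
    refine zero_or_zero_of_avoid hn (α := 0) (β := 1) (γ := 2) (by decide) (by decide) (by decide)
      (by decide) hA0 hB0 hC0 fun x hx y hy r hr r' hr' heq => ?_
    have ha' : mu • v₀ ∈ A 1 := (hA1 _).2 ⟨mu, hm, rfl⟩
    have hb : lam • v₁ ∈ B 1 := (hB1 _).2 ⟨lam, hl, rfl⟩
    have key := hS.2 0 1 0 x hx (mu • v₀) ha' (lam • v₁) hb (-y) (negmem hB0 hy)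
      r hr r' hr' (by rw [← heq]; abel)
    exact h01 key.1
  · -- pattern (0,0,1): a, a' ∈ A0, b ∈ B0, b' = μv₁ ∈ B1, c = λv₂ ∈ C1, c' ∈ C0
    refine zero_or_zero_of_avoid hn (α := 1) (β := 2) (γ := 0) (by decide) (by decide) (by decide)
      (by decide) hB0 hC0 hA0 fun x hx y hy r hr r' hr' heq => ?_
    have hb' : mu • v₁ ∈ B 1 := (hB1 _).2 ⟨mu, hm, rfl⟩
    have hc : lam • v₂ ∈ C 1 := (hC1 _).2 ⟨lam, hl, rfl⟩
    have key := hS.2 0 0 1 r hr r' hr' x hx (mu • v₁) hb' (lam • v₂) hc (-y)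
      (negmem hC0 hy) (by rw [← heq]; abel)
    exact h01 key.2
  · -- pattern (1,0,0): a = λv₀ ∈ A1, a' ∈ A0, b, b' ∈ B0, c ∈ C0, c' = μv₂ ∈ C1
    refine zero_or_zero_of_avoid hn (α := 0) (β := 2) (γ := 1) (by decide) (by decide) (by decide)
      (by decide) hA0 hC0 hB0 fun x hx y hy r hr r' hr' heq => ?_
    have ha : lam • v₀ ∈ A 1 := (hA1 _).2 ⟨lam, hl, rfl⟩
    have hc' : mu • v₂ ∈ C 1 := (hC1 _).2 ⟨mu, hm, rfl⟩
    have key := hS.2 1 0 0 (lam • v₀) ha (-x) (negmem hA0 hx) r hr r' hr' y hy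
      (mu • v₂) hc' (by rw [← heq]; abel)
    exact h01.symm key.1

/-- **Frame pairs are cyclic relabelings**, every modulus `n ≥ 5`.  Let `(v₀, v₁, v₂)` be three vectors of
`(ℤ/n)³` with `det (v₀, v₁, v₂) ≠ 0` and suppose the two triples `T_axes = (H₀∖0, H₁∖0, H₂∖0)` (index `0`)
and `T_v = ((ℤ/n ∖ 0)·v₀, (ℤ/n ∖ 0)·v₁, (ℤ/n ∖ 0)·v₂)` (index `1`) satisfy the simultaneous triple product
property.  Then either `v₀ ∈ H₁, v₁ ∈ H₂, v₂ ∈ H₀` or `v₀ ∈ H₂, v₁ ∈ H₀, v₂ ∈ H₁`.  Structural form, for all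
moduli `n ≥ 5` (prime or not), of the census finding `C_n = {rot, rot²}` (cell mm-stpp, engines A and B,
exhaustive for `3 ≤ n ≤ 32`). [cite: CohnKleinbergSzegedyUmans2005, Def. 5.1 and Prop. 5.2] -/
theorem frame_pair_classification (hn : 5 ≤ n)
    (hA0 : ∀ x, x ∈ A 0 ↔ x 0 ≠ 0 ∧ ∀ j, j ≠ 0 → x j = 0)
    (hB0 : ∀ x, x ∈ B 0 ↔ x 1 ≠ 0 ∧ ∀ j, j ≠ 1 → x j = 0)
    (hC0 : ∀ x, x ∈ C 0 ↔ x 2 ≠ 0 ∧ ∀ j, j ≠ 2 → x j = 0)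
    (hA1 : ∀ x, x ∈ A 1 ↔ ∃ c : ZMod n, c ≠ 0 ∧ x = c • v₀)
    (hB1 : ∀ x, x ∈ B 1 ↔ ∃ c : ZMod n, c ≠ 0 ∧ x = c • v₁)
    (hC1 : ∀ x, x ∈ C 1 ↔ ∃ c : ZMod n, c ≠ 0 ∧ x = c • v₂)
    (hdet : Matrix.det (Matrix.of ![v₀, v₁, v₂]) ≠ 0)
    (hS : AddSimultaneousTPP A B C) :
    (v₀ 0 = 0 ∧ v₀ 2 = 0 ∧ v₁ 0 = 0 ∧ v₁ 1 = 0 ∧ v₂ 1 = 0 ∧ v₂ 2 = 0) ∨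
    (v₀ 0 = 0 ∧ v₀ 1 = 0 ∧ v₁ 1 = 0 ∧ v₁ 2 = 0 ∧ v₂ 0 = 0 ∧ v₂ 2 = 0) := by
  have hn3 : 3 ≤ n := by omega
  obtain ⟨c01, c12, c02⟩ := two_line_conditions hn3 hA0 hB0 hC0 hA1 hB1 hC1 hS
  have L01 := parallel_pair_of_vectors hn c01   -- (v₁ 0 = 0 ∧ v₀ 0 = 0) ∨ (v₁ 1 = 0 ∧ v₀ 1 = 0)
  have L12 := parallel_pair_of_vectors hn c12   -- (v₂ 1 = 0 ∧ v₁ 1 = 0) ∨ (v₂ 2 = 0 ∧ v₁ 2 = 0)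
  have L02 := parallel_pair_of_vectors hn c02   -- (v₀ 0 = 0 ∧ v₂ 0 = 0) ∨ (v₀ 2 = 0 ∧ v₂ 2 = 0)
  have hd : Matrix.det (Matrix.of ![v₀, v₁, v₂]) =
      v₀ 0 * v₁ 1 * v₂ 2 - v₀ 0 * v₁ 2 * v₂ 1 - v₀ 1 * v₁ 0 * v₂ 2 + v₀ 1 * v₁ 2 * v₂ 0 +
        v₀ 2 * v₁ 0 * v₂ 1 - v₀ 2 * v₁ 1 * v₂ 0 := by
    rw [Matrix.det_fin_three]; rfl
  rw [hd] at hdet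
  rcases L01 with ⟨h10, h00⟩ | ⟨h11, h01⟩
  · -- `v₀, v₁ ∈ {x₀ = 0}`
    rcases L02 with ⟨-, h20⟩ | ⟨h02, h22⟩
    · exfalso; apply hdet; rw [h00, h10, h20]; ring
    rcases L12 with ⟨h21, h11⟩ | ⟨-, h12⟩
    · exact Or.inl ⟨h00, h02, h10, h11, h21, h22⟩
    · exfalso; apply hdet; rw [h00, h10, h02, h12]; ring
  · -- `v₀, v₁ ∈ {x₁ = 0}`
    rcases L12 with ⟨h21, -⟩ | ⟨h22, h12⟩
    · exfalso; apply hdet; rw [h01, h11, h21]; ring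
    rcases L02 with ⟨h00, h20⟩ | ⟨h02, -⟩
    · exact Or.inr ⟨h00, h01, h11, h12, h20, h22⟩
    · exfalso; apply hdet; rw [h01, h11, h02, h12]; ring

end Classification

/-! ### Three frames: the cyclic relabelings together fail -/

/-- **`{axes, rot, rot²}` is not STPP** in `(ℤ/n)³`, `n ≥ 2`.  With `T₀ = (P₀, P₁, P₂)`, `T₁ = (P₁, P₂, P₀)`,
`T₂ = (P₂, P₀, P₁)` (`Pᵢ` the punctured axis `Hᵢ∖0`), the pattern `(i,j,k) = (0,1,2)` of CKSU Def. 5.1 (ii)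
has the solution `a = b' = e₀`, `c = a' = e₁`, `b = c' = e₂`. [cite: CohnKleinbergSzegedyUmans2005, Def. 5.1] -/
theorem not_addSimultaneousTPP_axes_rot_rot2 (hn : 2 ≤ n) {A B C : Fin 3 → Finset (Fin 3 → ZMod n)}
    (hA0 : ∀ x, x ∈ A 0 ↔ x 0 ≠ 0 ∧ ∀ j, j ≠ 0 → x j = 0)
    (hC0 : ∀ x, x ∈ C 0 ↔ x 2 ≠ 0 ∧ ∀ j, j ≠ 2 → x j = 0)
    (hA1 : ∀ x, x ∈ A 1 ↔ x 1 ≠ 0 ∧ ∀ j, j ≠ 1 → x j = 0)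
    (hB1 : ∀ x, x ∈ B 1 ↔ x 2 ≠ 0 ∧ ∀ j, j ≠ 2 → x j = 0)
    (hB2 : ∀ x, x ∈ B 2 ↔ x 0 ≠ 0 ∧ ∀ j, j ≠ 0 → x j = 0)
    (hC2 : ∀ x, x ∈ C 2 ↔ x 1 ≠ 0 ∧ ∀ j, j ≠ 1 → x j = 0) :
    ¬ AddSimultaneousTPP A B C := by
  intro hS
  have h1 : (1 : ZMod n) ≠ 0 := by
    have := natCast_ne_zero_of_lt (n := n) (k := 1) one_pos (by omega); simpa using this
  have e_mem : ∀ (i : Fin 3) (P : Finset (Fin 3 → ZMod n)),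
      (∀ x, x ∈ P ↔ x i ≠ 0 ∧ ∀ j, j ≠ i → x j = 0) → Pi.single i (1 : ZMod n) ∈ P := by
    intro i P hP
    rw [hP]; exact ⟨by simp [h1], fun j hj => by simp [Pi.single_eq_of_ne hj]⟩
  have key := hS.2 0 1 2 (Pi.single 0 1) (e_mem 0 _ hA0) (Pi.single 1 1) (e_mem 1 _ hA1)
    (Pi.single 2 1) (e_mem 2 _ hB1) (Pi.single 0 1) (e_mem 0 _ hB2) (Pi.single 1 1) (e_mem 1 _ hC2)
    (Pi.single 2 1) (e_mem 2 _ hC0) (by abel)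
  exact absurd key.1 (by decide)

/-! ### Strengthening: every modulus `n ≥ 4` (scalar pairs `(2,1)`, `(3,2)`: `b′ = 2b`, `3b = 2b′ = 4b`)

`_four` versions of the statements above with `4 ≤ n`.  At `n = 3` the counting lemma is false
(`a = a′ = b = 1`, `b′ = 2`) and the two-line conditions admit 64 further frames of `𝔽₃³` (enumeration),
so `n = 3` needs the remaining index patterns of Def. 5.1 (ii) and rests on the engines' census. -/

section Four

variable {A B C : Fin 2 → Finset (Fin 3 → ZMod n)} {v₀ v₁ v₂ : Fin 3 → ZMod n}

/-- Half of the counting step, `n ≥ 4`: `a = a' ≠ 0` forces `b = b' = 0`. [folklore] -/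
theorem eq_zero_of_eq_of_ne_zero_four (hn : 4 ≤ n) {a b b' : ZMod n} (ha : a ≠ 0)
    (h : ∀ lam mu : ZMod n, lam ≠ 0 → mu ≠ 0 → lam * a - mu * a = 0 ∨ lam * b - mu * b' = 0) :
    b = 0 ∧ b' = 0 := by
  have h1 : (1 : ZMod n) ≠ 0 := by
    have := natCast_ne_zero_of_lt (n := n) (k := 1) one_pos (by omega); simpa using this
  have h2 : (2 : ZMod n) ≠ 0 := by
    have := natCast_ne_zero_of_lt (n := n) (k := 2) two_pos (by omega); simpa using this
  have h3 : (3 : ZMod n) ≠ 0 := by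
    have := natCast_ne_zero_of_lt (n := n) (k := 3) three_pos (by omega); simpa using this
  have e21 := (h 2 1 h2 h1).resolve_left fun h0 => ha (by linear_combination h0)
  have e32 := (h 3 2 h3 h2).resolve_left fun h0 => ha (by linear_combination h0)
  exact ⟨by linear_combination 2 * e21 - e32, by linear_combination 3 * e21 - 2 * e32⟩

/-- **Two lines with a two-coordinate alternative are jointly planar** over `ℤ/n`, every `n ≥ 4`
(supersedes `parallel_pair_of_two_line`). [folklore] -/
theorem parallel_pair_of_two_line_four (hn : 4 ≤ n) {a a' b b' : ZMod n}
    (h : ∀ lam mu : ZMod n, lam ≠ 0 → mu ≠ 0 → lam * a - mu * a' = 0 ∨ lam * b - mu * b' = 0) :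
    (a = 0 ∧ a' = 0) ∨ (b = 0 ∧ b' = 0) := by
  have h1 : (1 : ZMod n) ≠ 0 := by
    have := natCast_ne_zero_of_lt (n := n) (k := 1) one_pos (by omega); simpa using this
  by_cases ha : a = 0 ∧ a' = 0
  · exact Or.inl ha
  by_cases hb : b = 0 ∧ b' = 0
  · exact Or.inr hb
  exfalso
  rcases h 1 1 h1 h1 with e | e
  · -- `a = a'`
    have haa : a = a' := by linear_combination e
    subst haa
    have ha0 : a ≠ 0 := fun h0 => ha ⟨h0, h0⟩
    exact hb (eq_zero_of_eq_of_ne_zero_four hn ha0 h)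
  · -- `b = b'`
    have hbb : b = b' := by linear_combination e
    subst hbb
    have hb0 : b ≠ 0 := fun h0 => hb ⟨h0, h0⟩
    exact ha (eq_zero_of_eq_of_ne_zero_four hn hb0 fun lam mu hl hm => (h lam mu hl hm).symm)

/-- Vector form of `parallel_pair_of_two_line_four`. [folklore] -/
theorem parallel_pair_of_vectors_four (hn : 4 ≤ n) {u u' : Fin 3 → ZMod n} {α β : Fin 3}
    (h : ∀ lam mu : ZMod n, lam ≠ 0 → mu ≠ 0 → (lam • u - mu • u') α = 0 ∨ (lam • u - mu • u') β = 0) :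
    (u α = 0 ∧ u' α = 0) ∨ (u β = 0 ∧ u' β = 0) := by
  refine parallel_pair_of_two_line_four hn fun lam mu hl hm => ?_
  have := h lam mu hl hm
  simpa only [Pi.sub_apply, Pi.smul_apply, smul_eq_mul] using this

/-- **Frame pairs are cyclic relabelings, every modulus `n ≥ 4`** (statement of
`frame_pair_classification` with `4 ≤ n`; supersedes it). [cite: CohnKleinbergSzegedyUmans2005, Def. 5.1 and Prop. 5.2] -/
theorem frame_pair_classification_four (hn : 4 ≤ n)
    (hA0 : ∀ x, x ∈ A 0 ↔ x 0 ≠ 0 ∧ ∀ j, j ≠ 0 → x j = 0)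
    (hB0 : ∀ x, x ∈ B 0 ↔ x 1 ≠ 0 ∧ ∀ j, j ≠ 1 → x j = 0)
    (hC0 : ∀ x, x ∈ C 0 ↔ x 2 ≠ 0 ∧ ∀ j, j ≠ 2 → x j = 0)
    (hA1 : ∀ x, x ∈ A 1 ↔ ∃ c : ZMod n, c ≠ 0 ∧ x = c • v₀)
    (hB1 : ∀ x, x ∈ B 1 ↔ ∃ c : ZMod n, c ≠ 0 ∧ x = c • v₁)
    (hC1 : ∀ x, x ∈ C 1 ↔ ∃ c : ZMod n, c ≠ 0 ∧ x = c • v₂)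
    (hdet : Matrix.det (Matrix.of ![v₀, v₁, v₂]) ≠ 0)
    (hS : AddSimultaneousTPP A B C) :
    (v₀ 0 = 0 ∧ v₀ 2 = 0 ∧ v₁ 0 = 0 ∧ v₁ 1 = 0 ∧ v₂ 1 = 0 ∧ v₂ 2 = 0) ∨
    (v₀ 0 = 0 ∧ v₀ 1 = 0 ∧ v₁ 1 = 0 ∧ v₁ 2 = 0 ∧ v₂ 0 = 0 ∧ v₂ 2 = 0) := by
  have hn3 : 3 ≤ n := by omega
  obtain ⟨c01, c12, c02⟩ := two_line_conditions hn3 hA0 hB0 hC0 hA1 hB1 hC1 hS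
  have L01 := parallel_pair_of_vectors_four hn c01   -- (v₁ 0 = 0 ∧ v₀ 0 = 0) ∨ (v₁ 1 = 0 ∧ v₀ 1 = 0)
  have L12 := parallel_pair_of_vectors_four hn c12   -- (v₂ 1 = 0 ∧ v₁ 1 = 0) ∨ (v₂ 2 = 0 ∧ v₁ 2 = 0)
  have L02 := parallel_pair_of_vectors_four hn c02   -- (v₀ 0 = 0 ∧ v₂ 0 = 0) ∨ (v₀ 2 = 0 ∧ v₂ 2 = 0)
  have hd : Matrix.det (Matrix.of ![v₀, v₁, v₂]) =
      v₀ 0 * v₁ 1 * v₂ 2 - v₀ 0 * v₁ 2 * v₂ 1 - v₀ 1 * v₁ 0 * v₂ 2 + v₀ 1 * v₁ 2 * v₂ 0 +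
        v₀ 2 * v₁ 0 * v₂ 1 - v₀ 2 * v₁ 1 * v₂ 0 := by
    rw [Matrix.det_fin_three]; rfl
  rw [hd] at hdet
  rcases L01 with ⟨h10, h00⟩ | ⟨h11, h01⟩
  · -- `v₀, v₁ ∈ {x₀ = 0}`
    rcases L02 with ⟨-, h20⟩ | ⟨h02, h22⟩
    · exfalso; apply hdet; rw [h00, h10, h20]; ring
    rcases L12 with ⟨h21, h11⟩ | ⟨-, h12⟩
    · exact Or.inl ⟨h00, h02, h10, h11, h21, h22⟩
    · exfalso; apply hdet; rw [h00, h10, h02, h12]; ring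
  · -- `v₀, v₁ ∈ {x₁ = 0}`
    rcases L12 with ⟨h21, -⟩ | ⟨h22, h12⟩
    · exfalso; apply hdet; rw [h01, h11, h21]; ring
    rcases L02 with ⟨h00, h20⟩ | ⟨h02, -⟩
    · exact Or.inr ⟨h00, h01, h11, h12, h20, h22⟩
    · exfalso; apply hdet; rw [h01, h11, h02, h12]; ring

end Four

end FramePackingZMod

end Summit.MatrixMultiplication.MatrixMultiplication.Theorems
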